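/-
Copyright: the b2b-balaban cell (near-miss cell 7), T⁴-continuum fan-out; row NE7b ROUND-2 swarm, seat
t4-ne7b-formalise-leaf-03 (row S12 «ASSEMBLY» of `t4/b2b-balaban-t4-ne7b-p1/LEAVES-NE7b.md`; node A12 of the typer's
`t4/formal/NE7b/DAG.md`).  Released under the licence of the surrounding project.
-/
import Summits.QuantumFields.BalabanUV.T4Continuum.Support.HistoryFlow
import Summits.QuantumFields.BalabanUV.T4Continuum.Support.HistoryRegeneration
import Summits.QuantumFields.BalabanUV.T4Continuum.Support.HistoryTables

/-!
# History assembly over TREE SLOTS: the [CONV-D] exit at `D = 0` with every kernel-able binder plugged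

Summits-side support leaf of the T⁴-continuum cell (rung (B)+1 on a FINITE torus only; NOT infinite volume, NOT the
mass gap, NOT the Clay statement; NOT a proof of the spine estimate NE7b).  Row NE7b, route «COUNT», ROUND-2 swarm
row S12 ∕ typer node A12 — the TREE-SLOT form (journal FINDING F-leaf03-1, l.5804; typer T-NE7b-3, l.5663).
[folklore] COMPOSITION BY NAME of landed theorems of the cell; nothing is quoted from print, nothing printed is
asserted, no `[cite:]` tag, no `Prop`-valued fact is minted (trigger c1); (B), BetaPertH-flow and H3 are DISPLAYED (c4).

WHY.  The typer's finding T-NE7b-3 («the slot `(j, z, b, Q)` does not determine the genealogy: three consistent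
coalescents on one record») asks for a count over GENEALOGY TREES with slots `(j, z, G)`.  That count is LANDED: the
branching-records chain `T4BranchingRecordsGas` (trees `fam`, slots `BSlot γ δ = (j, z, G)`, budget `famSum_le` for every
fuel) → `T4TaggedShapeBanking` (prices of TAGGED genealogies `G′ : Gen ε` over an arbitrary label type, `sh : ε → PEv`;
no type collision of equal (step, class) constituents — F-ne7bp1g22-1(d)) → `T4CanonicalMenus` (thin menus, budgets
computed, `mem_canonFam_iff_chrono`) → `LateMergersCount` → the named-threshold exit
`CountThresholdExit.relWeightBound_lateMergers_of_irThreshold` (gen 21).  At horizon `D = 0` and `Δ = 1` that exit is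
the plain tree-slot count (`LateMergers.consistentTH_zero_iff`, `padW W 0 = W`): its labelled-price binder prices THE
tagged genealogy whose shape IS the slot's tree — no representative, no sum over coalescents.  The [CONV-D] absorption
clause is switched OFF by `D = 0`, not merged into another exit (trigger c3).

WHAT.  §1 clamping a run's couplings at the cutoff (`g K (min s K)`): the typed-flow predicates and the credits of
consistent tagged genealogies read steps `≤ K` only (`flowIneq27_clamp`, `flowIneq29_clamp`, `credit_clamp`,
`credits_clamp`), so the exit's unguarded profile binder `hP : ∀ K s, 0 ≤ p₀(g_{K,s})` is met along tuned runs.  §2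
`treeRates_of_large`: the exit's three rate binders (`Λ·e^{η̄₊−κ₁} < 1`, `Λ′e^{−κ₁}e^{η̄₊} < 1`, the fixed point) at
`η̄₊ = log 2`, `Λ = Λ′ = L^d`, from TWO largeness conditions on the free bank constants: `d·log L + 2·log 2 ≤ κ₁` and
`log (2 + birthMass C) ≤ E₀`.  §3 **`hybridNE7_of_treeBinders_canon`**: the exit at `D = 0`, `Δ = 1` along the TUNED runs
with the typed flow (S8 `HistoryFlow.flowBinders_of_tuned`), the cells and matching scale (S12 `HistoryTables`:
`cellN d n F.L`, `jhalf`), the rates (§2) and the two `Regeneration` runs (S11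
`HistoryRegeneration.regeneration_pair_of_cor3With`) PLUGGED, followed by the seam `CountSeamJunction.hybridNE7_of_eventually`.

WHAT REMAINS DISPLAYED (the census).  CONSTANTS: `ThresholdOK C F.L rr β₀`, `0 < C.μ`, the two largeness conditions
(free constants — S10's `HistoryConstantsExist` leaves `κ₁ E₀ Eb μ` free), the torus side `n`, the caps `Dcap`
(classes) and `Ncap` (fuel) — the budget is uniform in both.  FLOW (⇐ BetaPertH, `HistoryFlow.flowSide_of_betaPertHyp`):
box β-bounds, `γ ≤ γ₀`, `γ²β′ < 1`, `SmallnessFor γ β′ β₀ F.L pe`, `pe ≥ p₀, rr`; TUNING; the infrared smallness of the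
renormalised coupling against the NAMED threshold `irThresholdTH sh C F.L rr β₀ 0`; the (2.5) side condition `hR`.
(B): `SignConventions`, the pin `Cor3With`, bounded measurable observable, (α) both runs, floor (γ) both runs, site
budgets, envelopes.  H3: the abstract term family with the five numerator fields per run, AND the four TREE-SLOT (ID)
binders: `y K j z G ≥ 0`; `hlabT` — at every counted slot either `y ≤ 0` or a `ConsistentT`, `FreshT`, pending TAGGED
genealogy `G′` with `relabel (shape ∘ sh) G′ = G` and `y ≤ (L^d)^{partnerAges}·e^{−credits∘sh}·e^{+lifeCost costT}`;
`str`∕`hinj`∕`hstr` (bad classes labelled injectively by families of live tree slots containing an old one); `hF`∕`hF′`.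
SEAM: NE7c's `ShellWeightBound`, NE7's `ReindexedBudget`, four summable rates.  NOT HERE: the zone-crowding surcharge
`Kz^{#merges}·∏Q^p` (`hlabT` allows `(L^d)^{partnerAges}` only; the `hlabZ ⇒ hlabG ⇒ hlabM` steps of the records chain
are not yet transported to tree slots — F-leaf03-1 (4)); the socket structure over tree slots (rows S4∕S7∕S10 fill the
four binders directly or through it).  (ID) STATUS (referee OI-2, `t4/formal/NE7b/REFEREE.md` pass 2): the four
tree-slot (ID) binders are ASSUMED in this module — they are DISPLAYED hypotheses of §3 and are NOT closed here; their
suppliers are the tree-slot socket `Support/HistorySocketTH` (leaf-10) ∕ the term-keyed builder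
`Support/HistoryAssemblyTerms` (S12 §5), themselves fed by the (ID) reading rows S3–S7 ∕ S10 of the swarm table — so
nothing in this file counts as closing the socket.

HEADLINE (c4): «COUNT route, tree-slot form, reduced to H3 + (ID) tree-slot binders + (B) + BetaPertH-flow + NE7c
socket + NE7 core budget, displayed» — NOT «NE7b proved».  HONEST DEPENDENCY (cell): continuum YM on T⁴ ⇐ BetaPertH ∧ nine spine estimates
(0/9 proved); BetaPertH ⇐ (D1) ∧ (D4) ∧ CAP+tail.  This file changes none of it.
-/

open Finset MeasureTheory
open Literature.MathematicalPhysics.QuantumFieldTheory.Balaban1983to89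
open T4PersistenceDictionary T4PersistentHistoryCount T4BankedInduction T4PrintedShapeBanking
open T4WeightBudget T4GlobalDenominator T4LiveClassFibration T4LiveStructureGas T4LiveGasToTerms T4RecordPriceSeam
open T4PartnerMultiplicity T4IndicatorShell T4MatchingAssembly T4MatchingClosure T4MatchingClosureSocket T4Continuum
open T4StabilitySocket T4BranchingRecordsGas T4TaggedShapeBanking T4CanonicalMenus T4RenewalChains
open Summit.QuantumFields.BalabanUV.T4Continuum.PlacementBatch
open Summit.QuantumFields.BalabanUV.T4Continuum.PlacementSkeleton
open Summit.QuantumFields.BalabanUV.T4Continuum.CountThresholdUniform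
open Summit.QuantumFields.BalabanUV.T4Continuum.CountThresholdExit
open Summit.QuantumFields.BalabanUV.T4Continuum.CountSeamJunction
open Summit.QuantumFields.BalabanUV.T4Continuum.LateMergers
open Summit.QuantumFields.BalabanUV.T4Continuum.HistoryFlow
open Summit.QuantumFields.BalabanUV.T4Continuum.HistoryRegeneration
open Summit.QuantumFields.BalabanUV.T4Continuum.HistoryTables

namespace Summit.QuantumFields.BalabanUV.T4Continuum.HistoryAssemblyTrees

noncomputable section

/-! ## §1 Clamping a run's couplings at the cutoff -/

section Clamp

/-- (2.7) reads the couplings at steps `≤ K` only: it holds for the run clamped at the cutoff. [folklore] -/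
theorem flowIneq27_clamp {g : ℕ → ℝ} {β' β₀ : ℝ} {p K : ℕ} (h : B14.FlowIneq27 g β' β₀ p K) :
    B14.FlowIneq27 (fun s => g (min s K)) β' β₀ p K := by
  intro m n hmn hnK
  have hm : min m K = m := min_eq_left (le_of_lt (lt_of_lt_of_le hmn hnK))
  have hn : min n K = n := min_eq_left hnK
  simp only [hm, hn]
  exact h m n hmn hnK

/-- (2.9) reads the couplings at steps `≤ K` only. [folklore] -/
theorem flowIneq29_clamp {R : ℕ → ℕ} {g : ℕ → ℝ} {L : ℕ} {β' β₀ : ℝ} {K : ℕ}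
    (h : B14FlowStep.FlowIneq29 R g L β' β₀ K) : B14FlowStep.FlowIneq29 R (fun s => g (min s K)) L β' β₀ K := by
  intro m n hmn hnK
  have hn : min n K = n := min_eq_left hnK
  simp only [hn]
  exact h m n hmn hnK

/-- a raw credit at an event of step `≤ K` reads the couplings at steps `≤ K` only (birth: `g_j`; renewal: `g_{h}`,
`h + 1` its step; merger: nothing). [folklore] -/
theorem credit_clamp (C : T4PrintedShapeBanking.Consts) (g : ℕ → ℝ) {K : ℕ} {e : PEv} (he : e.step ≤ K) :
    credit C (fun s => g (min s K)) e = credit C g e := by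
  have h1 : min e.step K = e.step := min_eq_left he
  have h2 : min (e.step - 1) K = e.step - 1 := min_eq_left (le_trans (Nat.sub_le _ _) he)
  unfold credit
  simp only [h1, h2]

variable {ε : Type*} [DecidableEq ε]

/-- the credits of a `ConsistentT` tagged genealogy (all events at steps `≤ K`) are those of the clamped run.
[folklore] -/
theorem credits_clamp (sh : ε → PEv) (C : T4PrintedShapeBanking.Consts) (g : ℕ → ℝ) {K : ℕ} {R : ℕ → ℕ}
    {G : Gen ε} (hc : ConsistentT sh C K R G) :
    credits (credit C (fun s => g (min s K)) ∘ sh) G = credits (credit C g ∘ sh) G := by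
  unfold credits
  refine Finset.sum_congr rfl fun e he => ?_
  have hle : (sh e).step ≤ K :=
    (step_le_maxStep (PEv.step ∘ sh) G e he).trans (consistentT_maxStep_le hc)
  exact credit_clamp C g hle

end Clamp

/-! ## §2 The exit's three rates at `η̄₊ = log 2` from two largeness conditions on the free bank constants -/

section Rates

/-- **THE TREE-COUNT RATES FROM LARGE `κ₁` AND `E₀`.**  With `Λ = Λ′ = L^d`, `η̄₊ = log 2`, and `bm ≥ 0` the birth
mass: if `d·log L + 2·log 2 ≤ κ₁` (so `L^d·e^{−κ₁} ≤ ¼`) and `log (2 + bm) ≤ E₀` (so `e^{−E₀}·(2 + bm) ≤ 1`), then the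
root rate `L^d·e^{log 2 − κ₁} < 1`, the partner rate `L^d·e^{−κ₁}·e^{log 2} < 1`, and the fixed point
`(e^{−E₀} + e^{−E₀}·bm·(L^d e^{−κ₁}∕(1 − L^d e^{−κ₁} e^{log 2})))·e^{log 2} ≤ e^{log 2} − 1` hold. [folklore] -/
theorem treeRates_of_large {L : ℕ} (hL : 1 ≤ L) (d : ℕ) {κ₁ E₀ bm : ℝ} (hbm : 0 ≤ bm)
    (hκ : (d : ℝ) * Real.log L + 2 * Real.log 2 ≤ κ₁) (hE : Real.log (2 + bm) ≤ E₀) :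
    (L : ℝ) ^ d * Real.exp (Real.log 2 - κ₁) < 1 ∧
      (L : ℝ) ^ d * Real.exp (-κ₁) * Real.exp (Real.log 2) < 1 ∧
      (Real.exp (-E₀) + Real.exp (-E₀) * bm *
          ((L : ℝ) ^ d * Real.exp (-κ₁) / (1 - (L : ℝ) ^ d * Real.exp (-κ₁) * Real.exp (Real.log 2)))) *
        Real.exp (Real.log 2) ≤ Real.exp (Real.log 2) - 1 := by
  have h2 : Real.exp (Real.log 2) = 2 := Real.exp_log two_pos
  rw [h2]
  -- `q = L^d e^{−κ₁} ≤ ¼`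
  set q : ℝ := (L : ℝ) ^ d * Real.exp (-κ₁) with hq
  have hq0 : 0 ≤ q := by positivity
  have hq4 : q ≤ 1 / 4 := by
    have hq' : q = Real.exp ((d : ℝ) * Real.log L - κ₁) := by
      rw [hq, pow_eq_exp_mul_log hL d, ← Real.exp_add]; ring_nf
    rw [hq']
    have hle : (d : ℝ) * Real.log L - κ₁ ≤ -(2 * Real.log 2) := by linarith
    calc Real.exp ((d : ℝ) * Real.log L - κ₁) ≤ Real.exp (-(2 * Real.log 2)) := Real.exp_le_exp.2 hle
      _ = 1 / 4 := by
          rw [show -(2 * Real.log 2) = Real.log ((2 : ℝ) ^ 2)⁻¹ by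
            rw [Real.log_inv, Real.log_pow]; push_cast; ring]
          rw [Real.exp_log (by positivity)]; norm_num
  have hroot : (L : ℝ) ^ d * Real.exp (Real.log 2 - κ₁) = 2 * q := by
    rw [hq, Real.exp_sub, h2, Real.exp_neg]; ring
  refine ⟨by rw [hroot]; linarith, by linarith [hq4], ?_⟩
  -- the fixed point: `2e^{−E₀}(1 + bm·q∕(1−2q)) ≤ 1`
  have h12 : 1 / 2 ≤ 1 - q * 2 := by linarith
  have hfrac : q / (1 - q * 2) ≤ 1 / 2 := by
    rw [div_le_iff₀ (by linarith)]; linarith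
  have hE' : Real.exp (-E₀) * (2 + bm) ≤ 1 := by
    have h1 : 2 + bm ≤ Real.exp E₀ := by
      calc 2 + bm = Real.exp (Real.log (2 + bm)) := (Real.exp_log (by linarith)).symm
        _ ≤ Real.exp E₀ := Real.exp_le_exp.2 hE
    rw [Real.exp_neg]
    calc (Real.exp E₀)⁻¹ * (2 + bm) ≤ (Real.exp E₀)⁻¹ * Real.exp E₀ :=
          mul_le_mul_of_nonneg_left h1 (inv_nonneg.2 (Real.exp_pos _).le)
      _ = 1 := inv_mul_cancel₀ (Real.exp_pos _).ne'
  have he0 : 0 ≤ Real.exp (-E₀) := (Real.exp_pos _).le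
  have hmid : Real.exp (-E₀) * bm * (q / (1 - q * 2)) ≤ Real.exp (-E₀) * bm * (1 / 2) :=
    mul_le_mul_of_nonneg_left hfrac (mul_nonneg he0 hbm)
  nlinarith [hmid, hE', he0, hbm]

end Rates

/-! ## §3 The tree-slot exit at `D = 0` along the tuned runs, everything kernel-able plugged -/

section ExitLevel

variable {F : T4Family} {G : Type*} [GaugeGroup G] [MeasurableSpace G] [HaarData G] [RegularGaugeGroup G]
variable {ε : Type*} [DecidableEq ε]
variable {ι κc : Type*} [DecidableEq κc] [DecidableEq ι] {l₀ vol : ℝ} {K₀ : ℕ} {π : ℕ → ι → κc}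
  {T : ℕ → Finset ι} {A A' shA shB : ℕ → ℝ → ι → ℝ} {Bad' : ℕ → ℝ → Finset κc} {dead dead' : ℕ → ℝ → ι → ℝ}
  {Fc Rf Fc' Rf' : ℕ → κc → ℝ} {nup mup : ℕ → ℝ → ℝ} {Nup : ℝ}
  {Cc Rr CcRec RrRec : ℕ → ℝ → ι → ℝ} {ν u s₂ q₀ r s Wsh : ℕ → ℝ}

/-- **NE7b's COUNT EXIT OVER TREE SLOTS, ALL KERNEL-ABLE BINDERS PLUGGED.**
`CountThresholdExit.relWeightBound_lateMergers_of_irThreshold` at horizon `D = 0`, `Δ = 1` (the plain tree-slot count: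
`ConsistentTH … 0 ↔ ConsistentT`, `padW W 0 = W`) along the TUNED runs `D.C ⟨K, F.m, g₀ K⟩`, with the typed flow
(`HistoryFlow.flowBinders_of_tuned`, run clamped at the cutoff for the profile binder), cells `cellN d n F.L`, matching
scale `jhalf`, rates at `η̄₊ = log 2` (`treeRates_of_large`) and the two `Regeneration` runs
(`HistoryRegeneration.regeneration_pair_of_cor3With`) plugged, then `CountSeamJunction.hybridNE7_of_eventually`.
Displayed: constants (+ two largeness conditions), flow, tuning, `irThresholdTH sh C F.L rr β₀ 0 ≤ log g⁻²`, (2.5) side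
condition, (B) side, H3 numerator readings, the four TREE-SLOT (ID) binders (labelled price on THE tagged genealogy of
the slot), the seam data.  Weight: `constOf … · recordsBudget (birthMass C) κ₁ n^d L^d (log 2) jhalf`. [folklore] -/
theorem hybridNE7_of_treeBinders_canon (D : FiniteEpsData F G) (sh : ε → PEv) {C : T4PrintedShapeBanking.Consts}
    {rr : ℕ} {β₀ : ℝ} (h : ThresholdOK C F.L rr β₀) (hμ : 0 < C.μ) (d n : ℕ) (Dcap Ncap : ℕ → ℕ)
    -- two largeness conditions on the free bank constants
    (hκ₁ : (d : ℝ) * Real.log F.L + 2 * Real.log 2 ≤ C.κ₁) (hE₀ : Real.log (2 + birthMass C) ≤ C.E₀)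
    -- the flow side (⇐ BetaPertH, displayed) and tuning
    {γ₀ γb b β' : ℝ} {pe : ℕ} (hb : 0 ≤ b) (hlo : FlowStep.BetaLowerH b γ₀ D.βfun)
    (hhi : FlowStep.BetaUpperH β' γ₀ D.βfun) (hγ : γb ≤ γ₀) (hγβ : γb ^ 2 * β' < 1)
    (S : B14FlowStep.SmallnessFor γb β' β₀ F.L pe) (hp₀ : C.p₀ ≤ pe) (hrr : rr ≤ pe)
    {g : ℝ} {g₀ : ℕ → ℝ} (ht : D.Tuned γb g g₀)
    (hir : irThresholdTH sh C F.L rr β₀ 0 ≤ Real.log (g ^ 2)⁻¹)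
    -- the (B) side
    (hsign : B16.SignConventions D.C) {γB : ℝ} {em ep : ℝ → ℝ} (hcor : B16.Cor3With D.C γB em ep) (hγB : γb ≤ γB)
    {obs : (K : ℕ) → GaugeField (F.P K) 0 G → ℝ} {B : ℝ}
    (hobs : ∀ K, Measurable (obs K)) (hbd : ∀ K U, |obs K U| ≤ B)
    (hα : ∀ K t, |t| ≤ l₀ → K₀ ≤ K →
      ∫ U, Real.exp (t * obs K U) * D.dens K (g₀ K) 0 U ∂fieldMeasure (F.P K) 0 G ≤ ∑ τ ∈ T K, A K t τ)
    (hα' : ∀ K t, |t| ≤ l₀ → K₀ ≤ K →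
      ∫ U, Real.exp (t * obs (K + 1) U) * D.dens (K + 1) (g₀ (K + 1)) 0 U ∂fieldMeasure (F.P (K + 1)) 0 G ≤
        ∑ τ ∈ T K, A' K t τ)
    {c₀ n₁ : ℝ} (hc₀ : 0 < c₀) (hfloor : ∀ K, K₀ ≤ K → c₀ ≤ smallFieldMass D K (g₀ K))
    (hfloor' : ∀ K, K₀ ≤ K → c₀ ≤ smallFieldMass D (K + 1) (g₀ (K + 1)))
    (hsites : ∀ K, K₀ ≤ K → ((D.C ⟨K, F.m, g₀ K⟩).numSites K : ℝ) ≤ n₁)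
    (hsites' : ∀ K, K₀ ≤ K → ((D.C ⟨K + 1, F.m, g₀ (K + 1)⟩).numSites (K + 1) : ℝ) ≤ n₁)
    (hNup : 0 ≤ Nup) (hnup : ∀ K t, |t| ≤ l₀ → K₀ ≤ K → 0 ≤ nup K t ∧ nup K t ≤ Nup)
    (hmup : ∀ K t, |t| ≤ l₀ → K₀ ≤ K → 0 ≤ mup K t ∧ mup K t ≤ Nup)
    -- H3: the displayed numerator reading of both runs over the ABSTRACT term family
    (bad_subset : ∀ K t, |t| ≤ l₀ → K₀ ≤ K → Bad' K t ⊆ classIndex π T K)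
    (up : ∀ K t, |t| ≤ l₀ → K₀ ≤ K → ∀ c ∈ Bad' K t, ∀ τ ∈ fibre π T K c, A K t τ ≤ dead K t τ * Fc K c * nup K t)
    (dead_nonneg : ∀ K t, |t| ≤ l₀ → K₀ ≤ K → ∀ c ∈ Bad' K t, ∀ τ ∈ fibre π T K c, 0 ≤ dead K t τ)
    (resum : ∀ K t, |t| ≤ l₀ → K₀ ≤ K → ∀ c ∈ Bad' K t, ∑ τ ∈ fibre π T K c, dead K t τ ≤ Rf K c)
    (F_nonneg : ∀ K t, |t| ≤ l₀ → K₀ ≤ K → ∀ c ∈ Bad' K t, 0 ≤ Fc K c)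
    (up' : ∀ K t, |t| ≤ l₀ → K₀ ≤ K → ∀ c ∈ Bad' K t, ∀ τ ∈ fibre π T K c,
      A' K t τ ≤ dead' K t τ * Fc' K c * mup K t)
    (dead'_nonneg : ∀ K t, |t| ≤ l₀ → K₀ ≤ K → ∀ c ∈ Bad' K t, ∀ τ ∈ fibre π T K c, 0 ≤ dead' K t τ)
    (resum' : ∀ K t, |t| ≤ l₀ → K₀ ≤ K → ∀ c ∈ Bad' K t, ∑ τ ∈ fibre π T K c, dead' K t τ ≤ Rf' K c)
    (F'_nonneg : ∀ K t, |t| ≤ l₀ → K₀ ≤ K → ∀ c ∈ Bad' K t, 0 ≤ Fc' K c)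
    -- the (2.5) side condition on the size function the (ID) data are built over
    (R : ℕ → ℕ → ℕ) (hR : ∀ K s, s ≤ K → B14.IsRj F.L rr ((D.C ⟨K, F.m, g₀ K⟩).flow.g s) (R K s))
    -- the four TREE-SLOT (ID) binders over the canonical cells and the canonical run family
    (y : ℕ → ℕ → (Fin d → ℕ) → Gen PEv → ℝ)
    (hy0 : ∀ K, ∀ j ≤ K, ∀ z ∈ cellN d n F.L K (K - j), ∀ Gs ∈ canonFam Dcap Ncap K j, 0 ≤ y K j z Gs)
    (hlabT : ∀ K, K₀ ≤ K → ∀ j ≤ K, ∀ z ∈ cellN d n F.L K (K - j), ∀ Gs ∈ canonFam Dcap Ncap K j,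
      y K j z Gs ≤ 0 ∨ ∃ G' : Gen ε, ConsistentT sh C K (R K) G' ∧ FreshT G' ∧
        K < G'.reach (dictWT sh (R K) C.n₁) ∧ relabel (shape ∘ sh) G' = Gs ∧
        y K j z Gs ≤ ((F.L : ℝ) ^ d) ^ partnerAges (PEv.step ∘ sh) G' *
          (Real.exp (-credits (credit C (D.C ⟨K, F.m, g₀ K⟩).flow.g ∘ sh) G') *
            Real.exp (lifeCost (dictWT sh (R K) C.n₁) (costT sh C K (R K)) G')))
    (str : ℕ → κc → Finset (BSlot (Fin d → ℕ) PEv))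
    (hinj : ∀ K t, |t| ≤ l₀ → K₀ ≤ K → Set.InjOn (str K) (Bad' K t))
    (hstr : ∀ K t, |t| ≤ l₀ → K₀ ≤ K → ∀ cl ∈ Bad' K t,
      str K cl ⊆ bliveSlots (cellN d n F.L) (canonFam Dcap Ncap) K ∧
        ∃ o ∈ boldSlots (cellN d n F.L) (canonFam Dcap Ncap) jhalf K, o ∈ str K cl)
    (hF : ∀ K t, |t| ≤ l₀ → K₀ ≤ K → ∀ cl ∈ Bad' K t, Fc K cl * Rf K cl ≤ famWeight (bslotPrice (y K)) (str K cl))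
    (hF' : ∀ K t, |t| ≤ l₀ → K₀ ≤ K → ∀ cl ∈ Bad' K t,
      Fc' K cl * Rf' K cl ≤ famWeight (bslotPrice (y K)) (str K cl))
    -- the seam's other inputs (NE7c socket, NE7 core budget, four summable rates)
    (hSh : ShellWeightBound l₀ T A A' shA shB Wsh)
    (hTB : ReindexedBudget l₀ vol T (fun K t τ => A K t τ - shA K t τ) (fun K t τ => A' K t τ - shB K t τ)
      (badOfClass π T Bad') Cc Rr CcRec RrRec ν u s₂ q₀ r s)
    (hr : Summable r) (hu : Summable u) (hs : Summable s) (hs₂ : Summable s₂) :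
    ∃ K₁ K₂, K₀ ≤ K₁ ∧ HybridNE7 l₀ vol (fun K => T (K₁ + (K₂ + K))) (fun K => A (K₁ + (K₂ + K)))
      (fun K => A' (K₁ + (K₂ + K))) (fun K => badOfClass π T Bad' (K₁ + (K₂ + K)))
      (fun K => constOf l₀ B (max (em g) 0) n₁ c₀ Nup *
        recordsBudget (birthMass C) C.κ₁ ((n : ℝ) ^ d) ((F.L : ℝ) ^ d) (Real.log 2) jhalf (K₁ + (K₂ + K)))
      (fun K => shA (K₁ + (K₂ + K))) (fun K => shB (K₁ + (K₂ + K))) (fun K => Wsh (K₁ + (K₂ + K)))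
      (fun K => (r (K₁ + (K₂ + K)) + u (K₁ + (K₂ + K))) + (s (K₁ + (K₂ + K)) + s₂ (K₁ + (K₂ + K)))) := by
  -- (i) the typed flow along the tuned runs (S8), clamped at the cutoff
  obtain ⟨h27, h29, hx1, -⟩ := flowBinders_of_tuned D hb hlo hhi hγ hγβ S hp₀ hrr ht R hR
  set gr : ℕ → ℕ → ℝ := fun K s => (D.C ⟨K, F.m, g₀ K⟩).flow.g (min s K) with hgr
  have h27' : ∀ K, K₀ ≤ K → B14.FlowIneq27 (gr K) β' β₀ C.p₀ K := fun K _ => flowIneq27_clamp (h27 K)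
  have h29' : ∀ K, K₀ ≤ K → B14FlowStep.FlowIneq29 (R K) (gr K) F.L β' β₀ K := fun K _ => flowIneq29_clamp (h29 K)
  have hR' : ∀ K, K₀ ≤ K → ∀ s, s ≤ K → B14.IsRj F.L rr (gr K s) (R K s) := by
    intro K _ s hs
    show B14.IsRj F.L rr ((D.C ⟨K, F.m, g₀ K⟩).flow.g (min s K)) (R K s)
    rw [min_eq_left hs]; exact hR K s hs
  have hx1' : ∀ K, K₀ ≤ K → ∀ s, s ≤ K → 1 ≤ Real.log ((gr K s) ^ 2)⁻¹ := by
    intro K _ s hs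
    show 1 ≤ Real.log (((D.C ⟨K, F.m, g₀ K⟩).flow.g (min s K)) ^ 2)⁻¹
    rw [min_eq_left hs]; exact hx1 K s hs
  have hir' : ∀ K, K₀ ≤ K → irThresholdTH sh C F.L rr β₀ 0 ≤ Real.log ((gr K K) ^ 2)⁻¹ := by
    intro K _
    show _ ≤ Real.log (((D.C ⟨K, F.m, g₀ K⟩).flow.g (min K K)) ^ 2)⁻¹
    rw [min_self, (ht K).2]; exact hir
  have hP : ∀ K s, 0 ≤ p0Profile C.A₀ C.p₀ (gr K s) := fun K s =>
    p0Profile_nonneg_of_one_le_log C.p₀ h.A₀_pos.le (hx1 K (min s K) (min_le_right s K))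
  -- (iii) the two `Regeneration` runs with ONE constant (S11)
  obtain ⟨hA, hA'⟩ := regeneration_pair_of_cor3With D hsign hcor hγB ht hobs hbd hα hα' hc₀ hfloor hfloor' hsites
    hsites' hnup hmup bad_subset up dead_nonneg resum F_nonneg up' dead'_nonneg resum' F'_nonneg
  have hCn : 0 ≤ constOf l₀ B (max (em g) 0) n₁ c₀ Nup := constOf_nonneg hNup hc₀.le
  -- (ii) cells, matching scale, rates (S12 §1 + §2)
  have hL1 : 1 ≤ F.L := le_trans (by norm_num) (two_le_L F)
  have hLpos : (0 : ℝ) < F.L := by exact_mod_cast (lt_of_lt_of_le (by norm_num) hL1)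
  obtain ⟨hrate, h1, hx⟩ := treeRates_of_large hL1 d (birthMass_nonneg hμ) hκ₁ hE₀
  -- the labelled-price binder in the exit's `D = 0`, `Δ = 1` form, over the clamped run
  have hlab' : ∀ K, K₀ ≤ K → ∀ j ≤ K, ∀ z ∈ cellN d n F.L K (K - j), ∀ Gs ∈ canonFam Dcap Ncap K j,
      y K j z Gs ≤ 0 ∨ ∃ G' : Gen ε, ConsistentTH sh C K (R K) 0 G' ∧ FreshT G' ∧
        K - 0 < G'.reach (dictWT sh (R K) C.n₁) ∧ relabel (shape ∘ sh) G' = Gs ∧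
        y K j z Gs ≤ 1 * (((F.L : ℝ) ^ d) ^ partnerAges (PEv.step ∘ sh) G' *
          (Real.exp (-credits (credit C (gr K) ∘ sh) G') *
            Real.exp (lifeCost (padW (dictWT sh (R K) C.n₁) 0) (costT sh C K (R K)) G'))) := by
    intro K hK j hj z hz Gs hGs
    rcases hlabT K hK j hj z hz Gs hGs with h0 | ⟨G', hc, hf, hreach, hrel, hy⟩
    · exact Or.inl h0
    · refine Or.inr ⟨G', consistentTH_zero_iff.2 hc, hf, by simpa using hreach, hrel, ?_⟩
      rw [one_mul, padW_zero, credits_clamp sh C _ hc]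
      exact hy
  have hmain := relWeightBound_lateMergers_of_irThreshold sh h hμ (cellN d n F.L) (V := (n : ℝ) ^ d)
    (Λ := (F.L : ℝ) ^ d) (by positivity) (pow_pos hLpos d) (card_cellN_le d n hL1) Dcap Ncap jhalf jhalf_le
    (c := 1 / 2) (by norm_num) half_le_sub_jhalf 0 (Δ := 1) le_rfl hA hA' hCn R gr (fun _ => β') h27' h29' hR' hx1'
    hir' hP (Real.log_nonneg one_le_two) hrate (pow_nonneg hLpos.le d) h1 hx y hy0 hlab' str hinj hstr hF hF'
  have e0 : (1 : ℝ) * Real.exp (C.κ₁ * ((0 : ℕ) : ℝ)) * birthMass C = birthMass C := by simp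
  rw [e0] at hmain
  exact hybridNE7_of_eventually hmain hSh hTB hr hu hs hs₂

end ExitLevel

end

end Summit.QuantumFields.BalabanUV.T4Continuum.HistoryAssemblyTrees
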